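import Literature.MathematicalPhysics.QuantumFieldTheory.Balaban1983to89.Node00.LargeFieldReprOfRecord

/-!
# NODE 00 — THE TWO-RUN SITE TRANSPORT (the GEOMETRY half of node U5d): run B's level `j+1` IS run A's level `j`; blocking the finest sites of
# the cutoff-`(K+1)` torus by `L` lands on the finest sites of the cutoff-`K` torus, carries `(L·s)`-cubes ONTO `s`-cubes with the SAME index and
# the SAME index family, hence unions of cubes to unions of cubes and `𝐃^B_{j+1}` into `𝐃^A_j` EXACTLY WHEN the two (2.5) cube factors `R` agree;
# under that displayed coupling hypothesis the «drop level 1, block by L» truncation of run B's (2.18) indices into run A's is an honest function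

Cell `pub-ymgap`, YM-PLAN Track A (HUMAN RULING D-0062); seat `pub-ymgap-dag-n20-d` (R134 (a) N20 NE7b s3) gen 26 — TYPED AS DESIGN EVIDENCE for the seat's
bus OFFER (pub-ymgap INBOX, 2026-08-27 «DAGN20D-G26 LOCATED-U5d + OFFER»); filed ONLY on dag-lead's explicit GO (WAKE-only base).  [III] =
[Balaban1988Convergent], [I] = [Balaban1987RG1].

WHY.  The K5 spine readings of route `BalabanUVNodes` compare Bałaban's TWO RUNS of the renormalization group for one datum — run A with `K₀ + K` steps from
spacing `L^{-(K₀+K)}`, run B with `K₀ + K + 1` steps from spacing `L^{-(K₀+K+1)}` — and sum run B's (2.18) term classes «into run A's classes» along a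
truncation map (node U5d).  `Thm/BalabanUVNodesN19TargetClassWeightsE1` (p553397) takes that map as a PARAMETER
`tr K : SeqOfRecord F ν M (gB K) (K₀+K+1) (K₀+K+1) → SeqOfRecord F ν M (gA K) (K₀+K) (K₀+K)`, and `Node00/DressedSlotsOfRecord` records «node U5d … with the
site-type transport … is NOT here».  This file supplies what of U5d IS torus geometry and stops exactly where it stops being geometry:
* the site transport `Site (F.P (K+1)) (j+1) ≃ Site (F.P K) j` — both tori have `2·L^{m+K−j}` sites per direction (`Params.sitesPerDir`), run B's level `j+1`
  is run A's level `j`;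
* the block-down map of FINEST sites `Site (F.P (K+1)) 0 → Site (F.P K) 0` ([I] (0.3)'s block map followed by the transport) and its action on the universal
  cover: `blockDown ∘ cover = cover ∘ (coordinatewise Euclidean division by L)`;
* cubes: the `(L·s)`-cube of index `a` (any collar `n`) of run B's finest lattice blocks down ONTO the `s`-cube of the SAME index `a` of run A's, and the two
  index families `cubeIndices` COINCIDE; hence unions of `(L·s)`-cubes block down to unions of `s`-cubes with the same index set;
* `𝐃_j` of record: `dCubeSide L M R (j+1) = L · dCubeSide L M R j`, so `Ω ∈ 𝐃^B_{j+1}` (cube factor `R(g^B_{j+1})`) blocks down into the unions of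
  `L^j·M·R(g^B_{j+1})`-cubes — which IS `𝐃^A_j` iff `RkOfRecord L r (g^B_{j+1}) = RkOfRecord L r (g^A_j)`.  (2.5)'s `R_j` = least `L^s ≥ (log g_j⁻²)^r` is
  COUPLING-DEPENDENT and piecewise constant with jumps, and the two runs' coupling histories are different tunings, not index shifts: THIS equality is a
  FLOW statement, displayed below as the hypothesis `RAgree`, never asserted;
* under `RAgree` the truncation `truncSeq : Seq (𝐃^B) (k+1) → Seq (𝐃^A) k` («drop run B's level-1 entry, block the others down by L») is a genuine
  function into run A's ADMISSIBLE sequences ((2.1) chain laws transported), with its window faces.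

WHAT IS NOT DECIDED HERE (a definer's ∕ planner's choice, recorded on the bus with the OFFER): whether node U5d's map of record is (a) this truncation with
a FALLBACK class off `RAgree` (E2 holds for any function — `Finset.sum_fiberwise_of_maps_to` —, only the bad-class semantics degrade on the jump window),
(b) a COUPLING-FREE key (blocked site-set sequences without `𝐃_j` membership; the (α) road's abstract `trunc` into `HIndex.Idx` is of this kind), or
(c) a pin of the two histories giving `RAgree`.  Nothing of Bałaban's is asserted; no node count moves (typed 28∕28 · discharged 5∕28); N19 ∕ N20 ∕ N21 ∕
N27 NOT discharged; no `sorry`, no `axiom`, no `instance`, no `notation`; one finite four-torus programme at fixed `ε` — NOT ℝ⁴, NOT OS, NOT a mass gap,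
NOT the Clay problem.
-/

noncomputable section

open scoped BigOperators

namespace Literature.MathematicalPhysics.QuantumFieldTheory.Balaban1983to89.Node00

open T4Continuum B14.Eq213MaximalDomains B15Eq112TorusCover B14DomainGeom B14.Eq218Concrete

variable (F : T4Family)

/-! ## §1  The site transport: run B's level `j+1` is run A's level `j` -/

/-- Both tori have `2·L^{m+K−j}` sites per direction at the corresponding levels: `(F.P (K+1)).sitesPerDir (j+1) = (F.P K).sitesPerDir j`.
[cite: Balaban1987RG1, (0.1) p.251 (bookkeeping)] -/
theorem sitesPerDir_succ_succ (K j : ℕ) : (F.P (K + 1)).sitesPerDir (j + 1) = (F.P K).sitesPerDir j := by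
  simp only [Params.sitesPerDir, T4Family.P_L, T4Family.P_m, T4Family.P_K]
  congr 1
  congr 1
  omega

/-- **THE SITE TRANSPORT** `T^{(j+1)}` of the cutoff-`(K+1)` torus `≃` `T^{(j)}` of the cutoff-`K` torus: coordinatewise the `ZMod` congruence along
`sitesPerDir_succ_succ`. [cite: Balaban1987RG1, (0.1) p.251 (bookkeeping)] -/
def siteEquivSucc (K j : ℕ) : Site (F.P (K + 1)) (j + 1) ≃ Site (F.P K) j :=
  Equiv.piCongrRight fun _ => (ZMod.ringEquivCongr (sitesPerDir_succ_succ F K j)).toEquiv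

/-- The transport acts coordinatewise by the `ZMod` congruence. [cite: Balaban1987RG1, (0.1) p.251 (bookkeeping)] -/
theorem siteEquivSucc_apply (K j : ℕ) (x : Site (F.P (K + 1)) (j + 1)) (μ : Fin 4) :
    siteEquivSucc F K j x μ = ZMod.ringEquivCongr (sitesPerDir_succ_succ F K j) (x μ) := rfl

/-- The transport preserves integer casts coordinatewise. [cite: Balaban1987RG1, (0.1) p.251 (bookkeeping)] -/
theorem siteEquivSucc_intCast (K j : ℕ) (z : Fin 4 → ℤ) :
    siteEquivSucc F K j (fun μ => ((z μ : ℤ) : ZMod ((F.P (K + 1)).sitesPerDir (j + 1)))) =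
      fun μ => ((z μ : ℤ) : ZMod ((F.P K).sitesPerDir j)) := by
  funext μ
  rw [siteEquivSucc_apply, map_intCast]

/-- The transport preserves natural-number casts coordinatewise. [cite: Balaban1987RG1, (0.1) p.251 (bookkeeping)] -/
theorem siteEquivSucc_natCast (K j : ℕ) (z : Fin 4 → ℕ) :
    siteEquivSucc F K j (fun μ => ((z μ : ℕ) : ZMod ((F.P (K + 1)).sitesPerDir (j + 1)))) =
      fun μ => ((z μ : ℕ) : ZMod ((F.P K).sitesPerDir j)) := by
  funext μ
  rw [siteEquivSucc_apply, map_natCast]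

/-! ## §2  Blocking run B's finest sites down onto run A's finest sites -/

/-- **THE BLOCK-DOWN MAP OF FINEST SITES**: [I] (0.3)'s block map `T^{(0)} → T^{(1)}` of the cutoff-`(K+1)` torus (integer division by `L`
coordinatewise, `blockOf`) followed by the transport `T^{(1)}_{K+1} ≃ T^{(0)}_K`. [cite: Balaban1987RG1, (0.3) p.252 (bookkeeping)] -/
def blockDown (K : ℕ) (x : Site (F.P (K + 1)) 0) : Site (F.P K) 0 :=
  siteEquivSucc F K 0 (blockOf x)

/-- The finest site count of the cutoff-`(K+1)` torus is `L` times that of the cutoff-`K` torus. [cite: Balaban1987RG1, (0.1) p.251 (bookkeeping)] -/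
theorem sitesPerDir_zero_succ (K : ℕ) : (F.P (K + 1)).sitesPerDir 0 = F.L * (F.P K).sitesPerDir 0 := by
  simp only [Params.sitesPerDir, T4Family.P_L, T4Family.P_m, T4Family.P_K, Nat.sub_zero]
  ring

/-- Integer bookkeeping behind `blockDown_cover`: for `0 < L`, `0 < N`, the Euclidean remainder of `z` modulo `L·N`, divided by `L`, is congruent to
`z / L` modulo `N`. [folklore] -/
private theorem emod_mul_ediv_emod (z : ℤ) {L N : ℤ} (hL : 0 < L) (hN : 0 < N) : z % (L * N) / L % N = z / L % N := by
  have hLN : L * N ≠ 0 := mul_ne_zero hL.ne' hN.ne'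
  have hdecomp : z = z % (L * N) + L * (N * (z / (L * N))) := by
    have := (Int.emod_add_mul_ediv z (L * N)).symm
    rw [mul_assoc] at this
    exact this
  conv_rhs => rw [hdecomp, Int.add_mul_ediv_left _ _ hL.ne', Int.add_mul_emod_self_left]

/-- **BLOCK-DOWN ON THE UNIVERSAL COVER**: blocking the image of an integer point `z` of run B's cover is the image, in run A's cover, of the
coordinatewise Euclidean quotient `z / L`. [cite: Balaban1987RG1, (0.3) p.252 (bookkeeping)] -/
theorem blockDown_cover (K : ℕ) (z : Pt 4) :
    blockDown F K (cover (F.P (K + 1)) z) = cover (F.P K) (fun i => z i / (F.L : ℤ)) := by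
  have hL : 0 < (F.L : ℤ) := by have := F.hL.2; exact_mod_cast (by omega : 0 < F.L)
  have hN : 0 < ((F.P K).sitesPerDir 0 : ℤ) := by exact_mod_cast Nat.pos_of_ne_zero ((F.P K).sitesPerDir_ne_zero 0)
  funext μ
  show ZMod.ringEquivCongr (sitesPerDir_succ_succ F K 0) (blockOf (cover (F.P (K + 1)) z) μ) = _
  simp only [blockOf, cover, map_natCast, T4Family.P_L]
  rw [← Int.cast_natCast, ZMod.intCast_eq_intCast_iff', Int.natCast_div, ZMod.val_intCast, sitesPerDir_zero_succ, Nat.cast_mul]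
  exact emod_mul_ediv_emod (z μ) hL hN

/-- The block-down image of a site set. [cite: Balaban1987RG1, (0.3) p.252 (bookkeeping)] -/
def blockDownSet (K : ℕ) (S : Set (Site (F.P (K + 1)) 0)) : Set (Site (F.P K) 0) :=
  blockDown F K '' S

/-- `blockDownSet` is monotone (images are). [cite: Balaban1987RG1, (0.3) p.252 (bookkeeping)] -/
theorem blockDownSet_mono (K : ℕ) {S T : Set (Site (F.P (K + 1)) 0)} (h : S ⊆ T) : blockDownSet F K S ⊆ blockDownSet F K T :=
  Set.image_mono h

/-- `blockDownSet ∅ = ∅`. [cite: Balaban1987RG1, (0.3) p.252 (bookkeeping)] -/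
@[simp] theorem blockDownSet_empty (K : ℕ) : blockDownSet F K (∅ : Set (Site (F.P (K + 1)) 0)) = ∅ :=
  Set.image_empty _

/-- `blockDownSet` of a finite double-indexed union is the union of the `blockDownSet`s. [cite: Balaban1987RG1, (0.3) p.252 (bookkeeping)] -/
theorem blockDownSet_biUnion (K : ℕ) {ι : Type*} (A : Finset ι) (S : ι → Set (Site (F.P (K + 1)) 0)) :
    blockDownSet F K (⋃ a ∈ A, S a) = ⋃ a ∈ A, blockDownSet F K (S a) := by
  unfold blockDownSet
  exact Set.image_iUnion₂ _ _

/-! ## §3  Cubes: the `(L·s)`-cube of index `a` blocks down ONTO the `s`-cube of index `a` -/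

/-- On `ℤ^d`: coordinatewise Euclidean division by `L > 0` maps the `(L·s)`-cube of index `a` with collar `L·c` ONTO the `s`-cube of index `a` with
collar `c` (any integer `c`: Euclidean division by a positive integer is monotone and `L·y ∕ L = y`). [folklore] -/
private theorem image_ediv_cubeExt {d : ℕ} {L : ℕ} (hL : 0 < L) (s : ℕ) (a : Pt d) (c : ℤ) :
    (fun z : Pt d => fun i => z i / (L : ℤ)) '' cubeExt (L * s) a ((L : ℤ) * c) = cubeExt s a c := by
  have hL' : (0 : ℤ) < L := by exact_mod_cast hL
  ext y
  simp only [Set.mem_image, cubeExt, Set.mem_setOf_eq, Nat.cast_mul]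
  constructor
  · rintro ⟨z, hz, rfl⟩ i
    obtain ⟨h1, h2⟩ := hz i
    show (s : ℤ) * a i - c ≤ z i / (L : ℤ) ∧ z i / (L : ℤ) ≤ (s : ℤ) * a i + s - 1 + c
    constructor
    · -- lower bound: `L·(s·a_i − c) ≤ z_i` ⇒ `s·a_i − c ≤ z_i / L`
      rw [Int.le_ediv_iff_mul_le hL']
      nlinarith
    · -- upper bound: `z_i ≤ L·(s·a_i + s + c) − 1 < L·(s·a_i + s + c)` ⇒ `z_i / L < s·a_i + s + c`
      have : z i / (L : ℤ) < (s : ℤ) * a i + s + c := by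
        rw [Int.ediv_lt_iff_lt_mul hL']
        nlinarith
      omega
  · intro hy
    refine ⟨fun i => (L : ℤ) * y i, fun i => ?_, ?_⟩
    · obtain ⟨h1, h2⟩ := hy i
      constructor <;> nlinarith
    · funext i
      simp [Int.mul_ediv_cancel_left _ hL'.ne']

/-- **CUBES BLOCK DOWN ONTO CUBES**: the `(L·s)`-cube of index `a`, enlarged by `n` layers, of run B's finest lattice blocks down ONTO the `s`-cube of the
SAME index `a`, enlarged by `n` layers, of run A's finest lattice. [cite: Balaban1988Convergent, (2.17) p.257 (bookkeeping)] -/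
theorem blockDownSet_cubeEnl (K s : ℕ) (a : Pt 4) (n : ℕ) :
    blockDownSet F K (cubeEnl (F.P (K + 1)) (F.L * s) a n) = cubeEnl (F.P K) s a n := by
  have hL : 0 < F.L := by have := F.hL.2; omega
  have hw : ((n * (F.L * s) : ℕ) : ℤ) = (F.L : ℤ) * ((n * s : ℕ) : ℤ) := by push_cast; ring
  unfold blockDownSet cubeEnl
  rw [Set.image_image, hw]
  calc (fun z => blockDown F K (cover (F.P (K + 1)) z)) '' cubeExt (F.L * s) a ((F.L : ℤ) * ((n * s : ℕ) : ℤ))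
      = (fun z : Pt 4 => cover (F.P K) (fun i => z i / (F.L : ℤ))) '' cubeExt (F.L * s) a ((F.L : ℤ) * ((n * s : ℕ) : ℤ)) :=
        Set.image_congr' fun z => blockDown_cover F K z
    _ = cover (F.P K) '' ((fun z : Pt 4 => fun i => z i / (F.L : ℤ)) '' cubeExt (F.L * s) a ((F.L : ℤ) * ((n * s : ℕ) : ℤ))) :=
        (Set.image_image (cover (F.P K)) (fun z : Pt 4 => fun i => z i / (F.L : ℤ)) _).symm
    _ = cover (F.P K) '' cubeExt s a ((n * s : ℕ) : ℤ) := by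
        exact congrArg (Set.image (cover (F.P K))) (image_ediv_cubeExt hL s a _)

/-- Ceiling-division bookkeeping behind `cubeIndices_mul`: for `0 < L`, `0 < s`, `⌈(L·N)∕(L·s)⌉ = ⌈N∕s⌉` in the `(X + s − 1)∕s` rendering of
`cubeIndices`. [folklore] -/
private theorem range_ceilDiv_mul {L s : ℕ} (hL : 0 < L) (hs : 0 < s) (N : ℕ) :
    Finset.range ((L * N + L * s - 1) / (L * s)) = Finset.range ((N + s - 1) / s) := by
  have hLs : 0 < L * s := Nat.mul_pos hL hs
  have key : ∀ t : ℕ, t < (L * N + L * s - 1) / (L * s) ↔ t < (N + s - 1) / s := by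
    intro t
    rw [← Nat.add_one_le_iff, ← Nat.add_one_le_iff, Nat.le_div_iff_mul_le hLs, Nat.le_div_iff_mul_le hs,
      add_one_mul, add_one_mul]
    have h1 : t * (L * s) + L * s ≤ L * N + L * s - 1 ↔ t * (L * s) < L * N := by
      constructor <;> intro h <;> omega
    have h2 : t * s + s ≤ N + s - 1 ↔ t * s < N := by
      constructor <;> intro h <;> omega
    rw [h1, h2, show t * (L * s) = L * (t * s) by ring]
    exact Nat.mul_lt_mul_left hL
  ext t
  simp only [Finset.mem_range, key]

/-- **THE INDEX FAMILIES COINCIDE**: the `(L·s)`-cube partition of run B's finest lattice and the `s`-cube partition of run A's have the SAME index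
family (`s ≥ 1`). [cite: Balaban1988Convergent, (2.17) p.257 (bookkeeping)] -/
theorem cubeIndices_mul (K : ℕ) {s : ℕ} (hs : 0 < s) : cubeIndices (F.P (K + 1)) (F.L * s) = cubeIndices (F.P K) s := by
  have hL : 0 < F.L := by have := F.hL.2; omega
  unfold cubeIndices
  rw [sitesPerDir_zero_succ, range_ceilDiv_mul hL hs]
  rfl

/-! ## §4  Unions of cubes and `𝐃_j` of record -/

/-- **UNIONS OF CUBES BLOCK DOWN TO UNIONS OF CUBES** with the same index set: `S ∈ unionsOfCubes (L·s)` of run B's finest lattice ⇒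
`blockDownSet S ∈ unionsOfCubes s` of run A's (`s ≥ 1`). [cite: Balaban1988Convergent, (2.1) p.254 (bookkeeping)] -/
theorem blockDownSet_mem_unionsOfCubes (K : ℕ) {s : ℕ} (hs : 0 < s) {S : Set (Site (F.P (K + 1)) 0)}
    (hS : S ∈ unionsOfCubes (F.P (K + 1)) (F.L * s)) : blockDownSet F K S ∈ unionsOfCubes (F.P K) s := by
  obtain ⟨A, hA, rfl⟩ := hS
  refine ⟨A, by rwa [← cubeIndices_mul F K hs], ?_⟩
  rw [blockDownSet_biUnion]
  refine Set.iUnion₂_congr fun a _ => ?_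
  exact blockDownSet_cubeEnl F K s a 0

/-- The `𝐃_j` cube side one level up is `L` times the side: `dCubeSide L M R (j+1) = L · dCubeSide L M R j`. [cite: Balaban1988Convergent, (2.1) p.254 (bookkeeping)] -/
theorem dCubeSide_succ (L M R j : ℕ) : dCubeSide L M R (j + 1) = L * dCubeSide L M R j := by
  unfold dCubeSide
  ring

/-- **`𝐃^B_{j+1}` BLOCKS DOWN INTO THE UNIONS OF `L^j·M·R(g^B_{j+1})`-CUBES** of run A's finest lattice (for `M ≥ 1`; `R ≥ 1` always): the geometry
carries run B's class one level down WITH RUN B's CUBE FACTOR. [cite: Balaban1988Convergent, (2.1) p.254, (2.5) p.255 (bookkeeping)] -/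
theorem blockDownSet_mem_of_mem_dOfRecord (ν : Stage7Numerics) {M : ℕ} (hM : 0 < M) (gB : ℕ → ℝ) (K j : ℕ)
    {Ω : Set (Site (F.P (K + 1)) 0)} (hΩ : Ω ∈ DOfRecord F ν M gB (K + 1) (j + 1)) :
    blockDownSet F K Ω ∈ unionsOfCubes (F.P K) (dCubeSide F.L M (RkOfRecord F.L ν.r (gB (j + 1))) j) := by
  have hL : 2 ≤ F.L := by have := F.hL.2; omega
  have hR : 0 < RkOfRecord F.L ν.r (gB (j + 1)) := by
    unfold RkOfRecord
    split_ifs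
    · exact pow_pos (by omega) _
    · exact one_pos
  have hside : 0 < dCubeSide F.L M (RkOfRecord F.L ν.r (gB (j + 1))) j := by
    unfold dCubeSide
    exact Nat.mul_pos (Nat.mul_pos (Nat.pow_pos (by omega)) hM) hR
  refine blockDownSet_mem_unionsOfCubes F K hside ?_
  simpa only [DOfRecord, T4Family.P_L, dCubeSide_succ] using hΩ

/-- **THE COUPLING HYPOTHESIS OF NODE U5d, DISPLAYED** (never asserted): along the window `1 ≤ j ≤ k` the (2.5) cube factors of run B at level `j+1`
and of run A at level `j` AGREE.  `RkOfRecord L r g` = least `L^s ≥ (log g⁻²)^r` is piecewise constant in `g` with jumps; two different tunings give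
this only off the jump window — a FLOW statement about the pair of histories, not geometry. [cite: Balaban1988Convergent, (2.5) p.255 (bookkeeping)] -/
def RAgree (ν : Stage7Numerics) (gA gB : ℕ → ℝ) (k : ℕ) : Prop :=
  ∀ j, 1 ≤ j → j ≤ k → RkOfRecord F.L ν.r (gB (j + 1)) = RkOfRecord F.L ν.r (gA j)

/-- Under `RAgree`, `𝐃^B_{j+1}` blocks down INTO `𝐃^A_j` on the window. [cite: Balaban1988Convergent, (2.1) p.254 (bookkeeping)] -/
theorem blockDownSet_mem_dOfRecord (ν : Stage7Numerics) {M : ℕ} (hM : 0 < M) {gA gB : ℕ → ℝ} {K k : ℕ} (hR : RAgree F ν gA gB k)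
    {j : ℕ} (h1 : 1 ≤ j) (hj : j ≤ k) {Ω : Set (Site (F.P (K + 1)) 0)} (hΩ : Ω ∈ DOfRecord F ν M gB (K + 1) (j + 1)) :
    blockDownSet F K Ω ∈ DOfRecord F ν M gA K j := by
  have h := blockDownSet_mem_of_mem_dOfRecord F ν hM gB K j hΩ
  rw [hR j h1 hj] at h
  simpa only [DOfRecord, T4Family.P_L] using h

/-! ## §5  The truncation of run B's (2.18) indices into run A's, under `RAgree` -/

/-- **THE TRUNCATION OF NODE U5d UNDER `RAgree`** («drop run B's level-1 entry, block the others down by L»): the run-B index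
`(Ω₁, …, Ω_{k+1}; Λ₁, …, Λ_{k+1})` over `𝐃^B` goes to the run-A index `(Ω'_1, …, Ω'_k; Λ'_1, …, Λ'_k)`, `Ω'_j = blockDownSet Ω_{j+1}`,
`Λ'_j = blockDownSet Λ_{j+1}`, normalised to `∅` off the window — an ADMISSIBLE run-A sequence: (2.1)'s `Λ_j ⊆ Ω_j`, `Ω_{j+1} ⊆ Λ_j` transport by
monotonicity of the image, membership in `𝐃^A_j` by §4. [cite: Balaban1988Convergent, (2.1) p.254, (2.18) p.257 (bookkeeping)] -/
def truncSeq (ν : Stage7Numerics) {M : ℕ} (hM : 0 < M) {gA gB : ℕ → ℝ} {K k : ℕ} (hR : RAgree F ν gA gB k)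
    (s : Seq (DOfRecord F ν M gB (K + 1)) (k + 1)) : Seq (DOfRecord F ν M gA K) k :=
  Seq.ofChain (fun j => blockDownSet F K (s.Ω (j + 1))) (fun j => blockDownSet F K (s.Λ (j + 1)))
    { memΩ := fun j h1 hj => blockDownSet_mem_dOfRecord F ν hM hR h1 hj (s.chain.memΩ (j + 1) (by omega) (by omega))
      memΛ := fun j h1 hj => blockDownSet_mem_dOfRecord F ν hM hR h1 hj (s.chain.memΛ (j + 1) (by omega) (by omega))
      Λ_subset := fun j h1 hj => blockDownSet_mono F K (s.chain.Λ_subset (j + 1) (by omega) (by omega))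
      Ω_succ_subset := fun j h1 hj => blockDownSet_mono F K (s.chain.Ω_succ_subset (j + 1) (by omega) (by omega)) }

/-- On the window the truncated index reads run B one level up: `Ω'_j = blockDownSet Ω_{j+1}`. [cite: Balaban1988Convergent, (2.18) p.257 (bookkeeping)] -/
theorem truncSeq_Ω (ν : Stage7Numerics) {M : ℕ} (hM : 0 < M) {gA gB : ℕ → ℝ} {K k : ℕ} (hR : RAgree F ν gA gB k)
    (s : Seq (DOfRecord F ν M gB (K + 1)) (k + 1)) {j : ℕ} (h1 : 1 ≤ j) (hj : j ≤ k) :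
    (truncSeq F ν hM hR s).Ω j = blockDownSet F K (s.Ω (j + 1)) :=
  Seq.ofChain_Ω _ h1 hj

/-- On the window the truncated index reads run B one level up: `Λ'_j = blockDownSet Λ_{j+1}`. [cite: Balaban1988Convergent, (2.18) p.257 (bookkeeping)] -/
theorem truncSeq_Λ (ν : Stage7Numerics) {M : ℕ} (hM : 0 < M) {gA gB : ℕ → ℝ} {K k : ℕ} (hR : RAgree F ν gA gB k)
    (s : Seq (DOfRecord F ν M gB (K + 1)) (k + 1)) {j : ℕ} (h1 : 1 ≤ j) (hj : j ≤ k) :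
    (truncSeq F ν hM hR s).Λ j = blockDownSet F K (s.Λ (j + 1)) :=
  Seq.ofChain_Λ _ h1 hj

/-- Off the window the truncated index is `∅` (the (2.18) normalisation). [cite: Balaban1988Convergent, (2.18) p.257 (bookkeeping)] -/
theorem truncSeq_Ω_off (ν : Stage7Numerics) {M : ℕ} (hM : 0 < M) {gA gB : ℕ → ℝ} {K k : ℕ} (hR : RAgree F ν gA gB k)
    (s : Seq (DOfRecord F ν M gB (K + 1)) (k + 1)) {j : ℕ} (hj : ¬ (1 ≤ j ∧ j ≤ k)) :
    (truncSeq F ν hM hR s).Ω j = ∅ :=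
  (truncSeq F ν hM hR s).Ω_off j hj

/-- **THE NO-LARGE-FIELD TERM TRUNCATES TO THE NO-LARGE-FIELD TERM**: if run B's index has `Ω_{j+1} = Λ_{j+1} = T_η` on its window, the truncated
run-A index has `Ω'_j = Λ'_j = T_η` on its window (blocking down is onto). [cite: Balaban1989LargeFieldI, (0.2) p.176 (bookkeeping)] -/
theorem blockDownSet_univ (K : ℕ) : blockDownSet F K (Set.univ : Set (Site (F.P (K + 1)) 0)) = Set.univ := by
  unfold blockDownSet
  rw [Set.image_univ, Set.range_eq_univ]
  intro y
  -- a preimage: lift `y` to `ℤ^4`, multiply by `L`, push to run B's cover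
  refine ⟨cover (F.P (K + 1)) (fun i => (F.L : ℤ) * lift (F.P K) y i), ?_⟩
  have hL : (F.L : ℤ) ≠ 0 := by have := F.hL.2; exact_mod_cast (by omega : F.L ≠ 0)
  rw [blockDown_cover]
  funext μ
  simp only [cover, lift, Int.mul_ediv_cancel_left _ hL, Int.cast_natCast, ZMod.natCast_zmod_val]

end Literature.MathematicalPhysics.QuantumFieldTheory.Balaban1983to89.Node00
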